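import Summits.HodgeConjecture.CorCM.MumfordTateRankFiveHodge
import Literature.AlgebraicGeometry.HodgeTheory.Sl2IsotypicTimesCMDivisorClasses
import HarnessLib

/-!
# The divisor side of the rung `dim MT(H¹(X)) = 5`, `X` NOT of CM type: every complex abelian variety NOT of CM type with
# `dim MT(H¹X) ≤ 5` is STABLY NONDEGENERATE — `B•(X^{N+1}) = D•(X^{N+1}) ⊗ ℂ` for every `N`

COR-CM (cell `pub-hodgecm2`, seat `b27` gen 35, count-neutral lane MT-RANK-FIVE-DIVISORS; theorems only, no definition, no
named fact; UNCONDITIONAL — nothing here uses or asserts HC_CM).  Sequel of `CorCM/MumfordTateRankFiveHodge` (gen 34: the Hodge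
conjecture for every non-CM `X` with `dim MT(H¹X) ≤ 5`, where the docstring of
`hodgeConjectureFor_powSucc_of_not_isOfCMType_of_finrank_hodgeLie_eq_four` left divisor generation open) and of the Literature
file `HodgeTheory/Sl2IsotypicTimesCMDivisorClasses` (Moonen–Zarhin 1999 Thm. (3.2)(2) PROVED for the `𝔰𝔩₂`-isotypic class:
`B(A^{N+1} × E^{N+1}) = D` for `A` non-CM of Hodge-group rank three and `E` a CM elliptic curve).

* **`isDivisorGenerated_powSucc_of_not_isOfCMType_of_finrank_hodgeLie_eq_four`** — for `X` NOT of CM type with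
  `dim_ℚ Lie Hg(H¹X) = 4` (`Hg = SL₂ × U(1)`): every power `X^{N+1}` has `B = D`; by `CorCM/MumfordTateRankFive`
  `X ∼ B^{a+1} × E^{b+1}` (`B` simple non-CM with `dim End⁰B = (dim B)²`, `dim B ≤ 2`; `E` a CM elliptic curve), so
  `X^{N+1} ≼ B^{K+1} × E^{K+1}`, which has `B = D` (`isDivisorGenerated_powSucc_prod_powSucc_of_finrank_hodgeLie_le_three_of_cmCurve`),
  and `B = D` descends along dominations (`isDivisorGenerated_of_avDominatedBy`);
  **`isStablyNondegenerate_of_not_isOfCMType_of_finrank_hodgeLie_eq_four`** — `X` is stably nondegenerate (Gordon Def. 7.6 /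
  Moonen–Zarhin condition (D)); `isDivisorGenerated_of_avDominatedBy_powSucc_…` — and so is everything dominated by a power.
* **`isStablyNondegenerate_of_not_isOfCMType_of_mtRank_le_five`** — EVERY complex abelian variety `X` NOT of CM type with
  `dim MT(H¹X) ≤ 5` is stably nondegenerate (`dim Lie Hg ≤ 3`: Murty's rung, `CorCM/MumfordTateRankFourDivisorClasses`; else
  `dim Lie Hg = 4`); `isDivisorGenerated_of_isIsogenous_powSucc_…`, `isDivisorGenerated_of_avDominatedBy_powSucc_…` — the
  isogeny classes of, and everything dominated by, its powers have `B = D`; `…_and_hodgeConjectureFor_…` — the pair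
  (`B = D`, HC) in the shape of gen 31's `isDivisorGenerated_and_hodgeConjectureFor_of_not_isOfCMType_of_mtRank_le_four`.

So the non-CM half of the Mumford–Tate ladder through rank `5` is settled in the strong form `B = D` on all powers (answering
the question raised in gen 34's docstring: a QM-surface factor produces NO exceptional classes against a CM elliptic curve);
the CM half of rank `5` (`rdim ∈ {4,…,8}`) is open.

## References
* [MoonenZarhin1999LowDim] B. Moonen, Yu. Zarhin, Math. Ann. 315 (1999) 711–733, §2 (2.1)–(2.2) and condition (D), §3
  Thm. (3.2)(2), (3.8)–(3.9) [corpus: paper:arxiv-math_9901113 p. 4, p. 6].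
* [Gordon1999HodgeAVSurvey] B. B. Gordon, *A survey of the Hodge conjecture for abelian varieties*, Thm. 7.5, Def. 7.6,
  Thm. 7.6.2, §7.3.2.
* [Hazama1989] F. Hazama, Duke Math. J. 58 (1989) 31–37.
* [vanGeemen1994HodgeAV] B. van Geemen, LNM 1594 (1994), §2.4–2.5, Lemma 3.7, Thm. 4.3.
* [MumfordAV1970] D. Mumford, *Abelian Varieties* (1970), §19 Thm. 1, Cor. 2 and p. 174.
-/

noncomputable section

open CategoryTheory CategoryTheory.Limits Module
open scoped BigOperators

namespace Summit.HodgeConjecture.CorCM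

open Literature.AlgebraicGeometry.Motives
open Literature.AlgebraicGeometry.Motives.AbelianVariety
open Literature.AlgebraicGeometry.Motives.HodgeStructure
open Literature.AlgebraicGeometry.HodgeTheory
open Literature.AlgebraicGeometry.Milne1999 (IsOfCMType)
open Literature.AlgebraicGeometry.Pohlmann1968 (isIsogenous_powSucc_biproduct)
open Summit.HodgeConjecture.CorCM.Domination

variable [HodgeTensorFacts.{0, 0}]

/-! ## §1 `dim Lie Hg(H¹X) = 4`, `X` not CM: all powers have `B = D` -/

section RankFive

variable {X : AbelianVariety ℂ} {n : ℕ}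

/-- **`B•(X^{N+1}) = D•(X^{N+1}) ⊗ ℂ` for every complex abelian variety `X` NOT of CM type with `dim_ℚ Lie Hg(H¹(X)) = 4`**
(`Hg = SL₂ × U(1)`, Moonen–Zarhin), every `N`, UNCONDITIONALLY.  By `exists_isIsogenous_two_powers_of_finrank_hodgeLie_eq_four`,
`X ∼ B^{a+1} × E^{b+1}` with `E` a CM elliptic curve and `B` simple, not CM, `dim End⁰(B) = (dim B)²`, `dim B ≤ 2` (so
`Lie Hg(H¹B) ⊄ End_Hdg`, `dim Lie Hg(H¹B) ≤ 3`, `not_le_endAlg_and_finrank_hodgeLie_le_three_of_factor`); hence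
`X^{N+1} ≼ (B^{K+1} × E^{K+1})^{N+1} ≼ B^{K'+1} × E^{K'+1}`, `K' = K + N(K+1)`, whose Hodge ring is generated by divisors
(Moonen–Zarhin Thm. (3.2)(2) proved for the `𝔰𝔩₂`-isotypic class,
`isDivisorGenerated_powSucc_prod_powSucc_of_finrank_hodgeLie_le_three_of_cmCurve`), and `B = D` descends along dominations.
[cite: MoonenZarhin1999LowDim, §2 (2.1)–(2.2), §3 Thm. (3.2)(2) and (3.8)–(3.9)] [cite: Gordon1999HodgeAVSurvey, Thm. 7.5 and §7.3.2]
[cite: MumfordAV1970, §19 Thm. 1 and p. 174] [cite: vanGeemen1994HodgeAV, §2.4–2.5 and Thm. 4.3] -/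
theorem isDivisorGenerated_powSucc_of_not_isOfCMType_of_finrank_hodgeLie_eq_four (hX : IsSmoothProjective n X.X)
    (hcm : ¬ IsOfCMType X)
    (h4 : haveI := BettiUniverse.finite hX 1
      Module.finrank ℚ (BettiUniverse.hodge exists_isReal_hodgeModel_holds hX 1).hodgeLie = 4) (N : ℕ) :
    IsDivisorGenerated (X.powSucc N) := by
  classical
  obtain ⟨r, B, nB, i, j, hS, hd, -, hXB, hij, hall, hcmi, hEi, hdimi, hdj1, -, hcmj⟩ :=
    exists_isIsogenous_two_powers_of_finrank_hodgeLie_eq_four hX hcm h4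
  obtain ⟨hneP, h3P⟩ := not_le_endAlg_and_finrank_hodgeLie_le_three_of_factor (hS i) (hd i) hcmi hEi hdimi
  set K := max (nB i) (nB j) with hK
  have hdom : AVDominatedBy X (((B i).powSucc K).prod ((B j).powSucc K)) :=
    (AVDominatedBy.of_isIsogenous hXB (AVDominatedBy.refl _)).trans
      ((avDominatedBy_biproduct_prod_of_forall_eq_or (fun l => ⨁ fun _ : Fin (nB l + 1) => B l) hij hall).trans
        ((avDominatedBy_biproduct_const_powSucc (B i) (le_max_left _ _)).prod
          (avDominatedBy_biproduct_const_powSucc (B j) (le_max_right _ _))))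
  have hdomN : AVDominatedBy (X.powSucc N)
      (((B i).powSucc (K + N * (K + 1))).prod ((B j).powSucc (K + N * (K + 1)))) :=
    (avDominatedBy_powSucc_of_avDominatedBy hdom N).trans ((avDominatedBy_powSucc_prod _ _ N).trans
      ((avDominatedBy_powSucc_powSucc (B i) K N).prod (avDominatedBy_powSucc_powSucc (B j) K N)))
  exact isDivisorGenerated_of_avDominatedBy hdomN
    (isDivisorGenerated_powSucc_prod_powSucc_of_finrank_hodgeLie_le_three_of_cmCurve hneP h3P hdj1 hcmj _)

/-- **A complex abelian variety NOT of CM type with `dim_ℚ Lie Hg(H¹(X)) = 4` is STABLY NONDEGENERATE** (Gordon Def. 7.6,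
Moonen–Zarhin condition (D): `B•(X^{N+1}) = D•(X^{N+1})` for all `N`), UNCONDITIONALLY — `rank Hg_ℂ = 2 = rdim X` in
Gordon's Thm. 7.5 (3). [cite: Gordon1999HodgeAVSurvey, Thm. 7.5 and Def. 7.6] [cite: MoonenZarhin1999LowDim, §3 Thm. (3.2)(2)] -/
theorem isStablyNondegenerate_of_not_isOfCMType_of_finrank_hodgeLie_eq_four (hX : IsSmoothProjective n X.X)
    (hcm : ¬ IsOfCMType X)
    (h4 : haveI := BettiUniverse.finite hX 1
      Module.finrank ℚ (BettiUniverse.hodge exists_isReal_hodgeModel_holds hX 1).hodgeLie = 4) :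
    IsStablyNondegenerate X := fun N =>
  isDivisorGenerated_powSucc_of_not_isOfCMType_of_finrank_hodgeLie_eq_four hX hcm h4 N

/-- **`B(X) = D(X)`** for `X` NOT of CM type with `dim_ℚ Lie Hg(H¹(X)) = 4` (the power `N = 0`).
[cite: Gordon1999HodgeAVSurvey, Thm. 7.5 and Def. 7.6] [cite: MoonenZarhin1999LowDim, §3 Thm. (3.2)(2)] -/
theorem isDivisorGenerated_of_not_isOfCMType_of_finrank_hodgeLie_eq_four (hX : IsSmoothProjective n X.X)
    (hcm : ¬ IsOfCMType X)
    (h4 : haveI := BettiUniverse.finite hX 1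
      Module.finrank ℚ (BettiUniverse.hodge exists_isReal_hodgeModel_holds hX 1).hodgeLie = 4) :
    IsDivisorGenerated X :=
  (isStablyNondegenerate_of_not_isOfCMType_of_finrank_hodgeLie_eq_four hX hcm h4).isDivisorGenerated

/-- **Everything dominated by a power** of such an `X` (abelian subvarieties, quotients, isogeny factors of `X^{N+1}`) has
`B = D`. [cite: vanGeemen1994HodgeAV, §2.4–2.5 and §3.6–3.7] [cite: MumfordAV1970, §19 Thm. 1 and Remark p. 169] -/
theorem isDivisorGenerated_of_avDominatedBy_powSucc_of_not_isOfCMType_of_finrank_hodgeLie_eq_four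
    (hX : IsSmoothProjective n X.X) (hcm : ¬ IsOfCMType X)
    (h4 : haveI := BettiUniverse.finite hX 1
      Module.finrank ℚ (BettiUniverse.hodge exists_isReal_hodgeModel_holds hX 1).hodgeLie = 4)
    {Y : AbelianVariety ℂ} {N : ℕ} (hY : AVDominatedBy Y (X.powSucc N)) : IsDivisorGenerated Y :=
  isDivisorGenerated_of_avDominatedBy hY (isDivisorGenerated_powSucc_of_not_isOfCMType_of_finrank_hodgeLie_eq_four hX hcm h4 N)

end RankFive

/-! ## §2 `dim MT(H¹X) ≤ 5`, `X` not CM: stably nondegenerate -/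

section MTRankFive

variable {X : AbelianVariety ℂ} {n : ℕ}

/-- **EVERY complex abelian variety `X` NOT of CM type with `dim MT(H¹(X)) ≤ 5` is STABLY NONDEGENERATE**:
`B•(X^{N+1}) = D•(X^{N+1}) ⊗ ℂ` for every `N`, UNCONDITIONALLY.  `dim Lie Hg + 1 ≤ dim MT ≤ 5`; if `dim Lie Hg ≤ 3` this is
Murty's rung (`X ∼ B^{m+1}`, `AbelianVariety.isDivisorGenerated_powSucc_of_finrank_hodgeLie_le_three`), else `dim Lie Hg = 4`
and §1 applies (`X ∼ B^{a+1} × E^{b+1}`, Moonen–Zarhin Thm. (3.2)(2) for the `𝔰𝔩₂`-isotypic class).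
[cite: Gordon1999HodgeAVSurvey, Thm. 7.5, Def. 7.6 and §7.3.2] [cite: MoonenZarhin1999LowDim, §2 (2.1)–(2.5) and §3 Thm. (3.2)] -/
theorem isStablyNondegenerate_of_not_isOfCMType_of_mtRank_le_five (hX : IsSmoothProjective n X.X) (h0 : 0 < X.dim)
    (hcm : ¬ IsOfCMType X)
    (h5 : haveI := BettiUniverse.finite hX 1
      (BettiUniverse.hodge exists_isReal_hodgeModel_holds hX 1).mtRank ≤ 5) :
    IsStablyNondegenerate X := by
  have hn : X.dim = n := schemeDim_eq_holds hX
  subst hn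
  haveI := BettiUniverse.finite hX 1
  haveI : Nontrivial (bettiCohomology X.X 1) := nontrivial_bettiCohomology_one h0
  obtain ⟨ψ⟩ := BettiUniverse.hodge_isPolarizable exists_isReal_hodgeModel_holds hX 1
  have hne : ¬ (BettiUniverse.hodge exists_isReal_hodgeModel_holds hX 1).hodgeLie ≤
      Subalgebra.toSubmodule (BettiUniverse.hodge exists_isReal_hodgeModel_holds hX 1).endAlg := fun h =>
    hcm ((isOfCMType_iff_mumfordTateLieAlgebra_le_endAlg hX).2 ((hodgeLie_le_endAlg_iff _).1 h))
  have hle := finrank_hodgeLie_add_one_le_mtRank (BettiUniverse.hodge exists_isReal_hodgeModel_holds hX 1) ψ (by simp)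
  intro N
  by_cases h3 : Module.finrank ℚ (BettiUniverse.hodge exists_isReal_hodgeModel_holds hX 1).hodgeLie ≤ 3
  · exact (AVSlots.powSucc X N).isDivisorGenerated_of_finrank_hodgeLie_le_three hne h3
  · have h4 : Module.finrank ℚ (BettiUniverse.hodge exists_isReal_hodgeModel_holds hX 1).hodgeLie = 4 := by omega
    exact isDivisorGenerated_powSucc_of_not_isOfCMType_of_finrank_hodgeLie_eq_four hX hcm h4 N

/-- **`B•(X^{N+1}) = D•(X^{N+1}) ⊗ ℂ`** for `X` NOT of CM type with `dim MT(H¹(X)) ≤ 5`, every `N`.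
[cite: Gordon1999HodgeAVSurvey, Thm. 7.5 and Def. 7.6] [cite: MoonenZarhin1999LowDim, §3 Thm. (3.2)] -/
theorem isDivisorGenerated_powSucc_of_not_isOfCMType_of_mtRank_le_five (hX : IsSmoothProjective n X.X) (h0 : 0 < X.dim)
    (hcm : ¬ IsOfCMType X)
    (h5 : haveI := BettiUniverse.finite hX 1
      (BettiUniverse.hodge exists_isReal_hodgeModel_holds hX 1).mtRank ≤ 5) (N : ℕ) :
    IsDivisorGenerated (X.powSucc N) :=
  isStablyNondegenerate_of_not_isOfCMType_of_mtRank_le_five hX h0 hcm h5 N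

/-- **`B(X) = D(X)`** for `X` NOT of CM type with `dim MT(H¹(X)) ≤ 5`. [cite: Gordon1999HodgeAVSurvey, Thm. 7.5 and Def. 7.6]
[cite: MoonenZarhin1999LowDim, §3 Thm. (3.2)] -/
theorem isDivisorGenerated_of_not_isOfCMType_of_mtRank_le_five (hX : IsSmoothProjective n X.X) (h0 : 0 < X.dim)
    (hcm : ¬ IsOfCMType X)
    (h5 : haveI := BettiUniverse.finite hX 1
      (BettiUniverse.hodge exists_isReal_hodgeModel_holds hX 1).mtRank ≤ 5) :
    IsDivisorGenerated X :=
  (isStablyNondegenerate_of_not_isOfCMType_of_mtRank_le_five hX h0 hcm h5).isDivisorGenerated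

/-- **The isogeny classes of the powers**: every complex abelian variety isogenous to some `X^{N+1}`, `X` NOT of CM type with
`dim MT(H¹(X)) ≤ 5`, has `B = D` (van Geemen Lemma 3.7). [cite: vanGeemen1994HodgeAV, §3.5–3.7 Lemma 3.7]
[cite: Gordon1999HodgeAVSurvey, Thm. 7.5 and Def. 7.6] -/
theorem isDivisorGenerated_of_isIsogenous_powSucc_of_not_isOfCMType_of_mtRank_le_five (hX : IsSmoothProjective n X.X)
    (h0 : 0 < X.dim) (hcm : ¬ IsOfCMType X)
    (h5 : haveI := BettiUniverse.finite hX 1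
      (BettiUniverse.hodge exists_isReal_hodgeModel_holds hX 1).mtRank ≤ 5)
    {A : AbelianVariety ℂ} {N : ℕ} (hA : A.IsIsogenous (X.powSucc N)) : IsDivisorGenerated A :=
  IsDivisorGenerated.of_isIsogenous hA (isDivisorGenerated_powSucc_of_not_isOfCMType_of_mtRank_le_five hX h0 hcm h5 N)

/-- **Everything dominated by a power** `X^{N+1}` (abelian subvarieties, quotients, isogeny factors), `X` NOT of CM type
with `dim MT(H¹(X)) ≤ 5`, has `B = D`. [cite: vanGeemen1994HodgeAV, §2.4–2.5 and §3.6–3.7] [cite: MumfordAV1970, §19 Thm. 1 and Remark p. 169] -/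
theorem isDivisorGenerated_of_avDominatedBy_powSucc_of_not_isOfCMType_of_mtRank_le_five (hX : IsSmoothProjective n X.X)
    (h0 : 0 < X.dim) (hcm : ¬ IsOfCMType X)
    (h5 : haveI := BettiUniverse.finite hX 1
      (BettiUniverse.hodge exists_isReal_hodgeModel_holds hX 1).mtRank ≤ 5)
    {Y : AbelianVariety ℂ} {N : ℕ} (hY : AVDominatedBy Y (X.powSucc N)) : IsDivisorGenerated Y :=
  isDivisorGenerated_of_avDominatedBy hY (isDivisorGenerated_powSucc_of_not_isOfCMType_of_mtRank_le_five hX h0 hcm h5 N)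

/-- **The pair (`B = D`, HC) on all powers**, in the shape of gen 31's
`isDivisorGenerated_and_hodgeConjectureFor_powSucc_of_not_isOfCMType_of_mtRank_le_four`, now through Mumford–Tate rank `5`:
for `X` NOT of CM type with `dim MT(H¹(X)) ≤ 5`, every `X^{N+1}` has `B = D` and satisfies the Hodge conjecture
(`hodgeConjectureFor_of_isDivisorGenerated`, Lefschetz `(1,1)`). [cite: Gordon1999HodgeAVSurvey, Thm. 7.5–7.6 and §7.3.2]
[cite: MoonenZarhin1999LowDim, §2 condition (D) and §3 Thm. (3.2)] [cite: vanGeemen1994HodgeAV, §2.4] -/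
theorem isDivisorGenerated_and_hodgeConjectureFor_powSucc_of_not_isOfCMType_of_mtRank_le_five
    (hX : IsSmoothProjective n X.X) (h0 : 0 < X.dim) (hcm : ¬ IsOfCMType X)
    (h5 : haveI := BettiUniverse.finite hX 1
      (BettiUniverse.hodge exists_isReal_hodgeModel_holds hX 1).mtRank ≤ 5) (N : ℕ) :
    IsDivisorGenerated (X.powSucc N) ∧ HodgeConjectureFor (X.powSucc N).dim (X.powSucc N).X :=
  ⟨isDivisorGenerated_powSucc_of_not_isOfCMType_of_mtRank_le_five hX h0 hcm h5 N,
    hodgeConjectureFor_of_isDivisorGenerated _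
      (isDivisorGenerated_powSucc_of_not_isOfCMType_of_mtRank_le_five hX h0 hcm h5 N)⟩

end MTRankFive

end Summit.HodgeConjecture.CorCM

end
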